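import Summits.MatrixMultiplication.OmegaCensus.STPPVosperSlackOneCoverLawA2Wd
import Summits.MatrixMultiplication.OmegaCensus.STPPVosperCoverW342Asm
import Summits.MatrixMultiplication.OmegaCensus.STPPVosperCoverW342B29
import Summits.MatrixMultiplication.OmegaCensus.STPPVosperCoverW342B30
import Summits.MatrixMultiplication.OmegaCensus.STPPHamidouneRodsethInverseTheorem
import Summits.MatrixMultiplication.OmegaCensus.STPPDisjointPacking
import Summits.MatrixMultiplication.OmegaCensus.STPPVosperSlackOneCoverKillsZ59

/-!
# ω-census (abelian STPP census): `{(2,2,3),(3,4,2),(4,3,2)}` has no STPP family in `ℤ/59ℤ` — UNCONDITIONAL kernel kill by the slack-1 cover law WITH WORDS (kernel)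

HONEST FRAMING (pub-omega census; verbatim): lottery ticket; floor = certified bounds/negative ranges.
Census STRUCTURE (seat pub-omega-stpp-2 gen 25, 2026-08-28; leaf assigned by RULINGS L36-101/103 — the WORDS layer), family (b2).  The pattern
(`12 + 24 + 24 = 60 > 59`) is a leaf of the `ℤ₅₉` residual front of record left open by the window-table laws (survivors `±2⁻¹`).  Reading: the family
`(C, A, B)` (`stpp_rotate` twice), block `2` = `(2,4,3)`: `(z, L, vol, m, n) = (14, 16, 24, 17, 41)`, slack one.  The γ table has no rows; the α₂ and β tables have
the survivors `29, 30`; the PLAIN exact-cover stage does NOT close them (covers of `Y°`, `Z°` by the other blocks `(2,3,4)`, `(3,2,2)` exist), but NO cover is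
compatible with the Def-5.1 words among the two other blocks (`coverSearchW`, `STPPVosperCoverSearchW.lean`; rows `STPPVosperCoverW342A29L*/A30L*/B29/B30.lean`,
assembly `STPPVosperCoverW342Asm.lean`).  Law: `no_isSTPP_of_slack_one_coverW2_prime_a2` (`STPPVosperSlackOneCoverLawA2Wd.lean`) with
`hamidouneRodsethInverseTheorem_holds` — UNCONDITIONAL.  Python: HOME `pub-omega-stpp-2-g25/code/pilot/cover_wfull.py` (exact mirror), words_pilot.py.
Nothing here is progress on `ω`.

References: H. Cohn, R. Kleinberg, B. Szegedy, C. Umans, FOCS 2005 (arXiv:math/0511460), Def. 5.1; A. G. Vosper, J. London Math. Soc. 31 (1956);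
Y. O. Hamidoune, Ø. J. Rødseth, Acta Arith. 92 (2000) 251–262.
-/

open Finset
open scoped Pointwise

namespace Summit.MatrixMultiplication.OmegaCensus.CubeNB

open Literature.Computability.AlgebraicComplexity
open Literature.Combinatorics.Additive
open Summit.MatrixMultiplication.OmegaCensus.STPPKneser

/-! ## Tables -/

section Tables

/-- Tight-type (case γ) window table `(n, m, b) = (41, 17, 4)` at `59`: every admissible ratio is a word (in fact there are no rows). [folklore] -/
theorem table59_41_17_4_w342 : ∀ j < 59, ∀ t < 59, (∀ i' < 17, (t + j * i') % 59 < 41) →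
    (∀ k < 17, 4 ∣ (t + j * k) % 59 - #((range 17).filter fun i' => (t + j * i') % 59 < (t + j * k) % 59)) →
    j ∈ ({0, 1, 58, 2, 57, 3, 56} : Finset ℕ) := by
  decide +kernel

/-- Case-β table `(n+1, m, b) = (42, 17, 4)` at `59`: survivors `29, 30` beyond the words. [folklore] -/
theorem tableB59_42_17_4 : tableBeta 59 42 17 4 {0, 1, 58, 2, 57, 3, 56, 29, 30} = true := by
  decide +kernel

/-- Split of the β target: words, or (`j = 29, 30`) the failed words searches. [folklore] -/
theorem splitW342_beta : ∀ jv ∈ ({0, 1, 58, 2, 57, 3, 56, 29, 30} : Finset ℕ),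
    (jv = 0 ∨ (∃ k ∈ range 4, 1 ≤ k ∧ (jv = k ∨ jv + k = 59)) ∨ (∃ k ∈ range 2, 1 ≤ k ∧ (jv * k % 59 = 1 ∨ jv * k % 59 = 59 - 1))) ∨
      ((∀ k < 4 + 41 + 1, (2 ≤ k ∧ k + 2 ≤ 4 + 41) ∨ k = 0 ∨ k = 4 + 41 ∨
          (coverSearchW 59 ((List.range 16).map fun t => (jv * t) % 59) (List.range (14 - 1) ++ [k + 14 - 1]) [(2, 3, 4), (3, 2, 2)] = false ∨
            coverSearchW 59 (List.range (14 - 1) ++ [k + 14 - 1]) ((List.range 16).map fun t => (jv * t) % 59) [(3, 2, 4), (2, 3, 2)] = false)) ∧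
        (coverSearchW 59 ((List.range 16).map fun t => (jv * t) % 59) (List.range 14) [(2, 3, 4), (3, 2, 2)] = false ∨
          coverSearchW 59 (List.range 14) ((List.range 16).map fun t => (jv * t) % 59) [(3, 2, 4), (2, 3, 2)] = false)) := by
  intro jv hjv
  have hcases : jv ∈ ({0, 1, 58, 2, 57, 3, 56} : Finset ℕ) ∨ jv = 29 ∨ jv = 30 := by
    revert hjv; revert jv; decide
  rcases hcases with h | rfl | rfl
  · exact Or.inl (target_59_a2_b4 jv h)
  · exact Or.inr cw342_beta_j29
  · exact Or.inr cw342_beta_j30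

end Tables

/-! ## The kill -/

section Kill

/-- **`{(2,2,3),(3,4,2),(4,3,2)}` has no STPP family in `ℤ/59ℤ`** — UNCONDITIONAL (slack-1 law for `a = 2` with words, family `(C, A, B)`, block `2`; see the
module docstring). [cite: CohnKleinbergSzegedyUmans2005, Def. 5.1] [cite: Vosper1956, main theorem; Nathanson1996, Thm 2.7]
[cite: HamidouneRodseth2000, main theorem (§1, p. 252)] -/
theorem no_isSTPP_zmod59_223_342_432 (A B C : Fin 3 → Finset (ZMod 59)) (hS : IsSTPP A B C)
    (hA : ∀ i, #(A i) = ![2, 3, 4] i) (hB : ∀ i, #(B i) = ![2, 4, 3] i) (hC : ∀ i, #(C i) = ![3, 2, 2] i) : False := by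
  haveI : Fact (Nat.Prime 59) := ⟨by norm_num⟩
  have hS' : IsSTPP C A B := stpp_rotate (stpp_rotate hS)
  have hAne : ∀ i, (A i).Nonempty := fun i => card_pos.1 (by rw [hA]; fin_cases i <;> simp)
  have hBne : ∀ i, (B i).Nonempty := fun i => card_pos.1 (by rw [hB]; fin_cases i <;> simp)
  have hCne : ∀ i, (C i).Nonempty := fun i => card_pos.1 (by rw [hC]; fin_cases i <;> simp)
  have e2 : (univ : Finset (Fin 3)).erase 2 = {0, 1} := by decide
  have hz : ∑ k ∈ (univ : Finset (Fin 3)).erase 2, #(C k) * #(B k) = 14 := by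
    rw [e2, Finset.sum_pair (by decide)]; simp [hB, hC]
  have hL : ∑ k ∈ (univ : Finset (Fin 3)).erase 2, #(A k) * #(B k) = 16 := by
    rw [e2, Finset.sum_pair (by decide)]; simp [hA, hB]
  have ha : #(C 2) = 2 := by rw [hC]; simp
  have hb : #(A 2) = 4 := by rw [hA]; simp
  have hvol : #(C 2) * #(A 2) * #(B 2) = 24 := by rw [hA, hB, hC]; simp
  have hsAB : [(2, 3, 4), (3, 2, 2)] = ([1, 0] : List (Fin 3)).map (fun k => (#(C k), #(A k), #(B k))) := by simp [hA, hB, hC]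
  have hsBA : [(3, 2, 4), (2, 3, 2)] = ([1, 0] : List (Fin 3)).map (fun k => (#(A k), #(C k), #(B k))) := by simp [hA, hB, hC]
  exact no_isSTPP_of_slack_one_coverW2_prime_a2 hamidouneRodsethInverseTheorem_holds C A B hS' hCne hAne hBne 2 ⟨0, by decide⟩
    ha hb hvol hz hL rfl (by norm_num) (by norm_num) (by norm_num) (by norm_num) (m := 17) (n := 41) rfl rfl
    [1, 0] (by decide) (fun k => by fin_cases k <;> decide) [(2, 3, 4), (3, 2, 2)] hsAB [(3, 2, 4), (2, 3, 2)] hsBA true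
    (Jγ := {0, 1, 58, 2, 57, 3, 56}) (Jα := {0, 1, 58, 2, 57, 3, 56}) (Jβ := {0, 1, 58, 2, 57, 3, 56, 29, 30})
    table59_41_17_4_w342 (fun jv hjv => Or.inl (target_59_a2_b4 jv hjv)) specW342 target_59_a2_b4 tableB59_42_17_4 splitW342_beta

end Kill

end Summit.MatrixMultiplication.OmegaCensus.CubeNB
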